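import Summits.QuantumFields.YangMills.Theorems.BalabanUVNodesN15KingModelHeatKernelGradientProductMajorants
import Summits.QuantumFields.YangMills.Theorems.BalabanUVNodesN15KingModelHeatKernelGreenPowerLawFour
import HarnessLib

/-!
# BalabanUVNodes ∕ N15 — THE KING-MODEL RUNG (PART ∇-e): SUBORDINATION OF THE LATTICE GRADIENT OF KING's `A = 0` COVARIANCE AND THE TWO REGIONS OF ITS TIME INTEGRAL —
# `c·|G(x+e_ν,y) − G(x,y)| ≤ ∫₀^∞e^{−(m²∕c)s}‖∇Q_s((x−y)_ν)‖Π_{μ≠ν}‖Q_s((x−y)_μ)‖ds` (every torus), and on `(ℤ∕K₀)⁴`: `∫_{(T,∞)} ≤ 1∕(TK₀) + 8∕(T√T)` (NO mass), `∫_{(0,n²]} ≤ 617400∕n³` (`n = |v((x−y)_μ)| ≥ 1`)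
# (the integral half of PART ∇'s η-uniform inverse-cube law; PART ∇-f assembles `c|∇G| ≤ 4940000∕(1+tdistT)³`)
# (Track A, DAG node N15 = NE2; FAN-OUT v1.1 §N15 s3 «KING-MODEL RUNG … + what the curved case adds»; count-neutral)

HONEST FRAMING.  Count-neutral (cell `pub-ymgap`, seat `pub-ymgap-dag-n15-e` g57; `--supports stmt-QuantumFields-27247 --as helper` = K3ᴬ, KEY MAP v3).  King's `A = 0` comparison model:
the fine-lattice covariance `G = (c(−Δ)+m²)⁻¹` on the periodic torus `Π_μℤ∕K_μ` ([King1986] (2.13) p.653, (4.4) p.670); §3 on the cubic four-torus; NOT Bałaban's covariant `G_k(U)`, NOT [B9]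
(3.42); crude absolute constants.  THE MECHANISM: (i) SUBORDINATION of the difference (PART Ϣ-f `kingPlaneWave_eq_integral` twice): `G(x+e_ν,y) − G(x,y) = ∫₀^∞e^{−tm²}[Π_μQ_{ct}((x−y)_μ+δ_{μν}) −
Π_μQ_{ct}((x−y)_μ)]dt`, and the products differ in ONE factor: `= ∫₀^∞e^{−tm²}·∇Q_{ct}((x−y)_ν)·Π_{μ≠ν}Q_{ct}((x−y)_μ)dt` (★ `lapF_inv_grad_eq_integral`, with PART ∇-b's `∇Q = cycleHeatGrad`), hence
★★ `c|∇_νG(x,y)| ≤ ∫₀^∞e^{−(m²∕c)s}‖∇Q_s(z_ν)‖Π_{μ≠ν}‖Q_s(z_μ)‖ds` (`s = ct`); (ii) REGION II (`s ≥ T`, PART ∇-d `gradProd_le_far`, the mass weight DROPPED — the differenced kernel's tail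
`8e^{−8s∕K₀²}∕(sK₀³) + 8∕(s²√s)` is integrable on its own): `≤ 1∕(TK₀) + 8∕(T√T)`; (iii) REGION I (`0 < s ≤ n²`, PART ∇-d `gradProd_le_near`): `∫₀^{n²}308700∕(n⁴√s)ds = 617400∕n³` through the one
singular integral of the lineage ★ `integral_Ioc_inv_sqrt` (`∫₀^Tds∕√s = 2√T`, Mathlib `integral_rpow` at `r = −½`).
CONTENTS.  §1 integrals: ★ `integral_Ioc_inv_sqrt`, `integrableOn_inv_sqrt_Ioc`, `integral_Ioi_inv_sq_sqrt_le` (`∫_{(T,∞)}ds∕(s²√s) ≤ 1∕(T√T)`), `integral_Ioi_exp_div_le` (`∫_{(T,∞)}e^{−as}∕s ≤ 1∕(aT)`);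
§2 subordination on every torus: `add_unitVec_sub_apply_same`∕`_ne`, ★ `prod_shift_sub_prod`, ★ `lapF_inv_grad_eq_integral`, `integrableOn_gradMajorant`, ★★ **`mul_abs_lapF_inv_grad_le_integral`**;
§3 on `(ℤ∕K₀)⁴`: `integrableOn_gradMajorant_cM`, ★★ `integral_grad_far_le`, ★★ `integral_grad_near_le`.
PRIOR TREE ART (by name): PART Ϣ-f `kingPlaneWave_eq_integral` ∕ `integrableOn_heatIntegrand`, Ϣ-h `setIntegral_Ioi_eq_Ioc_add_Ioi` ∕ `integral_Ioi_exp_neg_mul_le_inv` ∕ `integral_Ioi_inv_sq_eq` ∕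
`integrableOn_inv_sq_Ioi`, Ϣ-d `continuous_cycleHeat` ∕ `norm_cycleHeat_le_one`, ∇-b `continuous_cycleHeatGrad` ∕ `norm_cycleHeatGrad_le_two`, ∇-d `gradProd_le_far` ∕ `gradProd_le_near`; Mathlib `integral_rpow`,
`intervalIntegral.intervalIntegrable_rpow'`, `intervalIntegral.integral_of_le`, `MeasureTheory.integral_comp_mul_left_Ioi`.
Dedup (rg at filing): basename 0 files; needles `lapF_inv_grad_eq_integral|mul_abs_lapF_inv_grad_le_integral|integral_Ioc_inv_sqrt|integrableOn_gradMajorant|integral_grad_far_le|prod_shift_sub_prod` 0 tree files.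
Locators: [King1986] (2.13) p.653, (4.4) p.670, (4.35) p.674, (3.63) p.663; [Hara2008] §2.1 (2.1), §2.6 (the split of the time integral); [LawlerLimic2010] Thm 4.3.1 ∕ §2.3.  0 `sorry`, 0 `def`.
-/

noncomputable section

open Real Set Finset MeasureTheory
open scoped BigOperators

namespace Summit.QuantumFields.YangMills.BalabanUVNodes.N15KingModelRung.HeatKernel

open Literature.MathematicalPhysics.QuantumFieldTheory.Balaban1983to89.B5Prop11Plancherel (Tor fine unitVec)
open Literature.MathematicalPhysics.QuantumFieldTheory.Balaban1983to89.Beta.WoodburyFibre (cM)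
open Literature.MathematicalPhysics.QuantumFieldTheory.King1986.Torus (lapF)

/-! ## §1 Four facts about integrals -/

/-- ★ THE ONE SINGULAR INTEGRAL: `∫_{(0,T]} ds∕√s = 2√T` (`T > 0`; Mathlib `integral_rpow` at `r = −½`). [folklore] -/
theorem integral_Ioc_inv_sqrt {T : ℝ} (hT : 0 < T) : ∫ s in Ioc (0 : ℝ) T, (Real.sqrt s)⁻¹ = 2 * Real.sqrt T := by
  rw [← intervalIntegral.integral_of_le hT.le]
  have hcongr : ∫ s in (0 : ℝ)..T, (Real.sqrt s)⁻¹ = ∫ s in (0 : ℝ)..T, s ^ (-(1 / 2 : ℝ)) := by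
    refine intervalIntegral.integral_congr fun s hs => ?_
    rw [Set.uIcc_of_le hT.le] at hs
    show (Real.sqrt s)⁻¹ = s ^ (-(1 / 2 : ℝ))
    rw [Real.rpow_neg hs.1, Real.sqrt_eq_rpow]
  rw [hcongr, integral_rpow (Or.inl (by norm_num))]
  rw [show (-(1 / 2 : ℝ)) + 1 = 1 / 2 by norm_num, Real.zero_rpow (by norm_num), sub_zero, ← Real.sqrt_eq_rpow]
  ring

/-- Integrability of `1∕√s` on `(0,T]`. [folklore] -/
theorem integrableOn_inv_sqrt_Ioc (T : ℝ) : IntegrableOn (fun s : ℝ => (Real.sqrt s)⁻¹) (Ioc (0 : ℝ) T) := by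
  have h := (intervalIntegral.intervalIntegrable_rpow' (a := (0 : ℝ)) (b := T) (r := -(1 / 2 : ℝ)) (by norm_num)).1
  refine h.congr_fun (fun s hs => ?_) measurableSet_Ioc
  show s ^ (-(1 / 2 : ℝ)) = (Real.sqrt s)⁻¹
  rw [Real.rpow_neg hs.1.le, Real.sqrt_eq_rpow]

/-- `∫_{(T,∞)} ds∕(s²√s) ≤ 1∕(T√T)` (`T > 0`; `√s ≥ √T` on the range and PART Ϣ-h's `∫_{(T,∞)}s⁻²ds = 1∕T`). [folklore] -/
theorem integral_Ioi_inv_sq_sqrt_le {T : ℝ} (hT : 0 < T) : ∫ s in Ioi T, 1 / (s ^ 2 * Real.sqrt s) ≤ 1 / (T * Real.sqrt T) := by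
  have hsT : 0 < Real.sqrt T := Real.sqrt_pos.mpr hT
  have hF : IntegrableOn (fun s : ℝ => (Real.sqrt T)⁻¹ * (1 / s ^ 2)) (Ioi T) := (integrableOn_inv_sq_Ioi hT).const_mul _
  have hpt : ∀ s ∈ Ioi T, 1 / (s ^ 2 * Real.sqrt s) ≤ (Real.sqrt T)⁻¹ * (1 / s ^ 2) := by
    intro s hs
    have hs0 : 0 < s := lt_trans hT hs
    have hsq : Real.sqrt T ≤ Real.sqrt s := Real.sqrt_le_sqrt (le_of_lt hs)
    rw [one_div, mul_inv, one_div, mul_comm]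
    exact mul_le_mul_of_nonneg_right (inv_anti₀ hsT hsq) (by positivity)
  have hG : IntegrableOn (fun s : ℝ => 1 / (s ^ 2 * Real.sqrt s)) (Ioi T) := by
    refine Integrable.mono' hF ?_ ?_
    · refine ContinuousOn.aestronglyMeasurable (fun s hs => ?_) measurableSet_Ioi
      have hs0 : 0 < s := lt_trans hT hs
      exact (continuousAt_const.div ((continuousAt_id.pow 2).mul Real.continuous_sqrt.continuousAt)
        (mul_pos (pow_pos hs0 2) (Real.sqrt_pos.mpr hs0)).ne').continuousWithinAt
    · refine (ae_restrict_iff' measurableSet_Ioi).mpr (Filter.Eventually.of_forall fun s hs => ?_)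
      have hs0 : 0 < s := lt_trans hT hs
      rw [Real.norm_eq_abs, abs_of_nonneg (by positivity)]
      exact hpt s hs
  calc ∫ s in Ioi T, 1 / (s ^ 2 * Real.sqrt s) ≤ ∫ s in Ioi T, (Real.sqrt T)⁻¹ * (1 / s ^ 2) := setIntegral_mono_on hG hF measurableSet_Ioi hpt
    _ = (Real.sqrt T)⁻¹ * (1 / T) := by rw [integral_const_mul, integral_Ioi_inv_sq_eq hT]
    _ = 1 / (T * Real.sqrt T) := by field_simp

/-- `∫_{(T,∞)} e^{−as}∕s ds ≤ 1∕(aT)` for `a, T > 0` (`1∕s ≤ 1∕T` on the range, PART Ϣ-h's `∫_{(T,∞)}e^{−as}ds ≤ 1∕a`). [folklore] -/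
theorem integral_Ioi_exp_div_le {a T : ℝ} (ha : 0 < a) (hT : 0 < T) : ∫ s in Ioi T, Real.exp (-(a * s)) / s ≤ 1 / (a * T) := by
  have hE : IntegrableOn (fun s : ℝ => Real.exp (-(a * s))) (Ioi T) := by
    have := exp_neg_integrableOn_Ioi T ha
    exact this.congr_fun (fun t _ => by ring_nf) measurableSet_Ioi
  have hF : IntegrableOn (fun s : ℝ => T⁻¹ * Real.exp (-(a * s))) (Ioi T) := hE.const_mul _
  have hpt : ∀ s ∈ Ioi T, Real.exp (-(a * s)) / s ≤ T⁻¹ * Real.exp (-(a * s)) := by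
    intro s hs
    have hs0 : 0 < s := lt_trans hT hs
    rw [div_eq_inv_mul]
    exact mul_le_mul_of_nonneg_right (inv_anti₀ hT (le_of_lt hs)) (Real.exp_pos _).le
  have hG : IntegrableOn (fun s : ℝ => Real.exp (-(a * s)) / s) (Ioi T) := by
    refine Integrable.mono' hF ?_ ?_
    · refine ContinuousOn.aestronglyMeasurable (fun s hs => ?_) measurableSet_Ioi
      have hs0 : 0 < s := lt_trans hT hs
      exact ((Real.continuous_exp.comp (by fun_prop)).continuousAt.div continuousAt_id hs0.ne').continuousWithinAt
    · refine (ae_restrict_iff' measurableSet_Ioi).mpr (Filter.Eventually.of_forall fun s hs => ?_)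
      have hs0 : 0 < s := lt_trans hT hs
      rw [Real.norm_eq_abs, abs_of_nonneg (by positivity)]
      exact hpt s hs
  calc ∫ s in Ioi T, Real.exp (-(a * s)) / s ≤ ∫ s in Ioi T, T⁻¹ * Real.exp (-(a * s)) := setIntegral_mono_on hG hF measurableSet_Ioi hpt
    _ = T⁻¹ * ∫ s in Ioi T, Real.exp (-(a * s)) := integral_const_mul _ _
    _ ≤ T⁻¹ * a⁻¹ := mul_le_mul_of_nonneg_left (integral_Ioi_exp_neg_mul_le_inv ha hT.le) (by positivity)
    _ = 1 / (a * T) := by field_simp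

/-! ## §2 Subordination of the lattice gradient (every torus `Π_μℤ∕K_μ`) -/

section Subordination

variable {d : ℕ} (K : Fin (d + 1) → ℕ) [hK : ∀ μ, NeZero (K μ)] {c m2 : ℝ}

omit hK in
/-- The shifted coordinate: `(x + e_ν − y)_ν = (x−y)_ν + 1`. [folklore] -/
theorem add_unitVec_sub_apply_same (x y : Tor K) (ν : Fin (d + 1)) : (x + unitVec K ν - y) ν = (x - y) ν + 1 := by
  simp only [unitVec, Pi.add_apply, Pi.sub_apply, Pi.single_eq_same]
  ring

omit hK in
/-- The other coordinates do not move: `(x + e_ν − y)_μ = (x−y)_μ` for `μ ≠ ν`. [folklore] -/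
theorem add_unitVec_sub_apply_ne (x y : Tor K) {ν μ : Fin (d + 1)} (h : μ ≠ ν) : (x + unitVec K ν - y) μ = (x - y) μ := by
  simp only [unitVec, Pi.add_apply, Pi.sub_apply, Pi.single_eq_of_ne h, add_zero]

/-- ★ DIFFERENCING ONE FACTOR: `Π_μQ_{s}((x+e_ν−y)_μ) − Π_μQ_s((x−y)_μ) = ∇Q_s((x−y)_ν)·Π_{μ≠ν}Q_s((x−y)_μ)`. [folklore] -/
theorem prod_shift_sub_prod (s : ℝ) (x y : Tor K) (ν : Fin (d + 1)) :
    (∏ μ : Fin (d + 1), cycleHeat (K μ) s ((x + unitVec K ν - y) μ)) - ∏ μ : Fin (d + 1), cycleHeat (K μ) s ((x - y) μ)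
      = cycleHeatGrad (K ν) s ((x - y) ν) * ∏ μ ∈ Finset.univ.erase ν, cycleHeat (K μ) s ((x - y) μ) := by
  classical
  rw [← Finset.mul_prod_erase Finset.univ (fun μ => cycleHeat (K μ) s ((x + unitVec K ν - y) μ)) (Finset.mem_univ ν),
    ← Finset.mul_prod_erase Finset.univ (fun μ => cycleHeat (K μ) s ((x - y) μ)) (Finset.mem_univ ν)]
  have hν : (x + unitVec K ν - y) ν = (x - y) ν + 1 := add_unitVec_sub_apply_same K x y ν
  have hrest : ∏ μ ∈ Finset.univ.erase ν, cycleHeat (K μ) s ((x + unitVec K ν - y) μ) = ∏ μ ∈ Finset.univ.erase ν, cycleHeat (K μ) s ((x - y) μ) := by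
    refine Finset.prod_congr rfl fun μ hμ => ?_
    rw [add_unitVec_sub_apply_ne K x y (Finset.ne_of_mem_erase hμ)]
  rw [hν, hrest, ← sub_mul]
  rfl

/-- ★ **SUBORDINATION OF THE GRADIENT**: `G(x+e_ν,y) − G(x,y) = ∫_{(0,∞)} e^{−tm²}·∇Q^{(K_ν)}_{ct}((x−y)_ν)·Π_{μ≠ν}Q^{(K_μ)}_{ct}((x−y)_μ)dt` (as complex numbers; `c ≥ 0`, `m² > 0`; PART Ϣ-f twice).
[cite: King1986, (2.13) p.653, (4.4) p.670, (4.35) p.674; Hara2008, §2.1 (2.1)] -/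
theorem lapF_inv_grad_eq_integral (hc : 0 ≤ c) (hm : 0 < m2) (x y : Tor K) (ν : Fin (d + 1)) :
    ((((lapF K c m2)⁻¹ (x + unitVec K ν) y - (lapF K c m2)⁻¹ x y : ℝ)) : ℂ)
      = ∫ t in Ioi (0 : ℝ), ((Real.exp (-(t * m2)) : ℝ) : ℂ) * (cycleHeatGrad (K ν) (t * c) ((x - y) ν) * ∏ μ ∈ Finset.univ.erase ν, cycleHeat (K μ) (t * c) ((x - y) μ)) := by
  rw [Complex.ofReal_sub, kingPlaneWave_eq_integral K hc hm (x + unitVec K ν) y, kingPlaneWave_eq_integral K hc hm x y,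
    ← integral_sub (integrableOn_heatIntegrand K hc hm _) (integrableOn_heatIntegrand K hc hm _)]
  refine integral_congr_ae (Filter.Eventually.of_forall fun t => ?_)
  show _ - _ = _
  rw [← mul_sub, prod_shift_sub_prod K (t * c) x y ν]

/-- Integrability of the gradient majorant `e^{−μ₀s}·‖∇Q_s(z_ν)‖·Π_{μ≠ν}‖Q_s(z_μ)‖` on `(0,∞)` (`μ₀ > 0`; dominated by `2e^{−μ₀s}`). [folklore] -/
theorem integrableOn_gradMajorant {μ0 : ℝ} (hμ : 0 < μ0) (z : Tor K) (ν : Fin (d + 1)) :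
    IntegrableOn (fun s : ℝ => Real.exp (-(μ0 * s)) * (‖cycleHeatGrad (K ν) s (z ν)‖ * ∏ μ ∈ Finset.univ.erase ν, ‖cycleHeat (K μ) s (z μ)‖)) (Ioi 0) := by
  have hmaj : IntegrableOn (fun s : ℝ => 2 * Real.exp (-(μ0 * s))) (Ioi 0) := by
    have := exp_neg_integrableOn_Ioi 0 hμ
    exact (this.congr_fun (fun t _ => by ring_nf) measurableSet_Ioi).const_mul 2
  refine Integrable.mono' hmaj ?_ ?_
  · refine Continuous.aestronglyMeasurable ?_
    refine Continuous.mul (Real.continuous_exp.comp (by fun_prop)) (Continuous.mul (continuous_cycleHeatGrad (K := K ν) (z ν)).norm ?_)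
    exact continuous_finsetProd _ fun μ _ => (continuous_cycleHeat (K := K μ) (z μ)).norm
  · refine (ae_restrict_iff' measurableSet_Ioi).mpr (Filter.Eventually.of_forall fun s hs => ?_)
    have hs0 : 0 ≤ s := le_of_lt hs
    have hP0 : 0 ≤ ∏ μ ∈ Finset.univ.erase ν, ‖cycleHeat (K μ) s (z μ)‖ := Finset.prod_nonneg fun μ _ => norm_nonneg _
    rw [Real.norm_eq_abs, abs_of_nonneg (mul_nonneg (Real.exp_pos _).le (mul_nonneg (norm_nonneg _) hP0))]
    have hprod : ∏ μ ∈ Finset.univ.erase ν, ‖cycleHeat (K μ) s (z μ)‖ ≤ 1 := by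
      calc ∏ μ ∈ Finset.univ.erase ν, ‖cycleHeat (K μ) s (z μ)‖ ≤ ∏ _μ ∈ Finset.univ.erase ν, (1 : ℝ) :=
            Finset.prod_le_prod (fun μ _ => norm_nonneg _) (fun μ _ => norm_cycleHeat_le_one hs0 (z μ))
        _ = 1 := by simp
    have hG := norm_cycleHeatGrad_le_two (K := K ν) hs0 (z ν)
    calc Real.exp (-(μ0 * s)) * (‖cycleHeatGrad (K ν) s (z ν)‖ * ∏ μ ∈ Finset.univ.erase ν, ‖cycleHeat (K μ) s (z μ)‖)
        ≤ Real.exp (-(μ0 * s)) * (2 * 1) := mul_le_mul_of_nonneg_left (mul_le_mul hG hprod hP0 zero_le_two) (Real.exp_pos _).le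
      _ = 2 * Real.exp (-(μ0 * s)) := by ring

/-- ★★ **`c·|G(x+e_ν,y) − G(x,y)| ≤ ∫₀^∞ e^{−(m²∕c)s}·‖∇Q^{(K_ν)}_s((x−y)_ν)‖·Π_{μ≠ν}‖Q^{(K_μ)}_s((x−y)_μ)‖ds`** (`c > 0`, `m² > 0`, every torus; substitution `s = ct`).
[cite: King1986, (2.13) p.653, (4.4) p.670, (4.35) p.674; Hara2008, §2.1 (2.1)] -/
theorem mul_abs_lapF_inv_grad_le_integral (hc : 0 < c) (hm : 0 < m2) (x y : Tor K) (ν : Fin (d + 1)) :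
    c * |(lapF K c m2)⁻¹ (x + unitVec K ν) y - (lapF K c m2)⁻¹ x y|
      ≤ ∫ s in Ioi (0 : ℝ), Real.exp (-(m2 / c * s)) * (‖cycleHeatGrad (K ν) s ((x - y) ν)‖ * ∏ μ ∈ Finset.univ.erase ν, ‖cycleHeat (K μ) s ((x - y) μ)‖) := by
  have h := lapF_inv_grad_eq_integral K hc.le hm x y ν
  have hn : |(lapF K c m2)⁻¹ (x + unitVec K ν) y - (lapF K c m2)⁻¹ x y| = ‖((((lapF K c m2)⁻¹ (x + unitVec K ν) y - (lapF K c m2)⁻¹ x y : ℝ)) : ℂ)‖ := by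
    rw [Complex.norm_real, Real.norm_eq_abs]
  have h1 : |(lapF K c m2)⁻¹ (x + unitVec K ν) y - (lapF K c m2)⁻¹ x y|
      ≤ ∫ t in Ioi (0 : ℝ), Real.exp (-(t * m2)) * (‖cycleHeatGrad (K ν) (t * c) ((x - y) ν)‖ * ∏ μ ∈ Finset.univ.erase ν, ‖cycleHeat (K μ) (t * c) ((x - y) μ)‖) := by
    rw [hn, h]
    refine (norm_integral_le_integral_norm _).trans (le_of_eq ?_)
    refine integral_congr_ae (Filter.Eventually.of_forall fun t => ?_)
    show ‖_‖ = _
    rw [norm_mul, Complex.norm_real, Real.norm_eq_abs, abs_of_pos (Real.exp_pos _), norm_mul, norm_prod]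
  -- substitution `s = c t`
  set g : ℝ → ℝ := fun s => Real.exp (-(m2 / c * s)) * (‖cycleHeatGrad (K ν) s ((x - y) ν)‖ * ∏ μ ∈ Finset.univ.erase ν, ‖cycleHeat (K μ) s ((x - y) μ)‖) with hg
  have hsub := integral_comp_mul_left_Ioi g 0 hc
  simp only [mul_zero] at hsub
  have hgt : ∀ t : ℝ, g (c * t) = Real.exp (-(t * m2)) * (‖cycleHeatGrad (K ν) (t * c) ((x - y) ν)‖ * ∏ μ ∈ Finset.univ.erase ν, ‖cycleHeat (K μ) (t * c) ((x - y) μ)‖) := by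
    intro t
    simp only [hg]
    rw [show m2 / c * (c * t) = t * m2 by field_simp, mul_comm c t]
  simp_rw [hgt] at hsub
  rw [hsub, smul_eq_mul] at h1
  have hc' : c * (c⁻¹ * ∫ s in Ioi (0 : ℝ), g s) = ∫ s in Ioi (0 : ℝ), g s := by
    rw [← mul_assoc, mul_inv_cancel₀ hc.ne', one_mul]
  calc c * |(lapF K c m2)⁻¹ (x + unitVec K ν) y - (lapF K c m2)⁻¹ x y| ≤ c * (c⁻¹ * ∫ s in Ioi (0 : ℝ), g s) := mul_le_mul_of_nonneg_left h1 hc.le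
    _ = ∫ s in Ioi (0 : ℝ), g s := hc'

end Subordination

/-! ## §3 The two regions of the time integral on the cubic four-torus -/

variable {K₀ : ℕ} [NeZero K₀] {c m2 : ℝ}

/-- The gradient majorant of §2 on the cubic torus: integrable on `(0,∞)`. [folklore] -/
theorem integrableOn_gradMajorant_cM (hc : 0 < c) (hm : 0 < m2) (z : Tor (cM K₀)) (ν : Fin 4) :
    IntegrableOn (fun s : ℝ => Real.exp (-(m2 / c * s)) * (‖cycleHeatGrad K₀ s (z ν)‖ * ∏ μ ∈ Finset.univ.erase ν, ‖cycleHeat K₀ s (z μ)‖)) (Ioi 0) :=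
  integrableOn_gradMajorant (cM K₀) (div_pos hm hc) z ν

/-- ★ REGION II: `∫_{(T,∞)} e^{−(m²∕c)s}‖∇Q_s(z_ν)‖Π_{μ≠ν}‖Q_s(z_μ)‖ds ≤ 1∕(TK₀) + 8∕(T√T)` for `T > 0` — PART ∇-d `gradProd_le_far`, the mass weight dropped, §1. [cite: King1986, (2.13) p.653, (4.4) p.670, (4.35) p.674] -/
theorem integral_grad_far_le (hc : 0 < c) (hm : 0 < m2) (z : Tor (cM K₀)) (ν : Fin 4) {T : ℝ} (hT : 0 < T) :
    ∫ s in Ioi T, Real.exp (-(m2 / c * s)) * (‖cycleHeatGrad K₀ s (z ν)‖ * ∏ μ ∈ Finset.univ.erase ν, ‖cycleHeat K₀ s (z μ)‖)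
      ≤ 1 / (T * K₀) + 8 / (T * Real.sqrt T) := by
  have hK : (0 : ℝ) < K₀ := by exact_mod_cast Nat.pos_of_ne_zero (NeZero.ne K₀)
  have ha : 0 < 8 / (K₀ : ℝ) ^ 2 := by positivity
  have hF := (integrableOn_gradMajorant_cM hc hm z ν).mono_set (Ioi_subset_Ioi hT.le)
  -- the two dominating integrands
  have hE : IntegrableOn (fun s : ℝ => Real.exp (-(8 / (K₀ : ℝ) ^ 2 * s)) / s) (Ioi T) := by
    have hE0 : IntegrableOn (fun s : ℝ => Real.exp (-(8 / (K₀ : ℝ) ^ 2 * s))) (Ioi T) := by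
      have := exp_neg_integrableOn_Ioi T ha
      exact this.congr_fun (fun t _ => by ring_nf) measurableSet_Ioi
    refine Integrable.mono' (hE0.const_mul T⁻¹) ?_ ?_
    · refine ContinuousOn.aestronglyMeasurable (fun s hs => ?_) measurableSet_Ioi
      have hs0 : 0 < s := lt_trans hT hs
      exact ((Real.continuous_exp.comp (by fun_prop)).continuousAt.div continuousAt_id hs0.ne').continuousWithinAt
    · refine (ae_restrict_iff' measurableSet_Ioi).mpr (Filter.Eventually.of_forall fun s hs => ?_)
      have hs0 : 0 < s := lt_trans hT hs
      rw [Real.norm_eq_abs, abs_of_nonneg (by positivity), div_eq_inv_mul]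
      exact mul_le_mul_of_nonneg_right (inv_anti₀ hT (le_of_lt hs)) (Real.exp_pos _).le
  have hI : IntegrableOn (fun s : ℝ => 1 / (s ^ 2 * Real.sqrt s)) (Ioi T) := by
    have hsT : 0 < Real.sqrt T := Real.sqrt_pos.mpr hT
    refine Integrable.mono' ((integrableOn_inv_sq_Ioi hT).const_mul (Real.sqrt T)⁻¹) ?_ ?_
    · refine ContinuousOn.aestronglyMeasurable (fun s hs => ?_) measurableSet_Ioi
      have hs0 : 0 < s := lt_trans hT hs
      exact (continuousAt_const.div ((continuousAt_id.pow 2).mul Real.continuous_sqrt.continuousAt)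
        (mul_pos (pow_pos hs0 2) (Real.sqrt_pos.mpr hs0)).ne').continuousWithinAt
    · refine (ae_restrict_iff' measurableSet_Ioi).mpr (Filter.Eventually.of_forall fun s hs => ?_)
      have hs0 : 0 < s := lt_trans hT hs
      have hsq : Real.sqrt T ≤ Real.sqrt s := Real.sqrt_le_sqrt (le_of_lt hs)
      rw [Real.norm_eq_abs, abs_of_nonneg (by positivity), one_div, mul_inv, one_div, mul_comm]
      exact mul_le_mul_of_nonneg_right (inv_anti₀ hsT hsq) (by positivity)
  have hG : IntegrableOn (fun s : ℝ => 8 / (K₀ : ℝ) ^ 3 * (Real.exp (-(8 / (K₀ : ℝ) ^ 2 * s)) / s) + 8 * (1 / (s ^ 2 * Real.sqrt s))) (Ioi T) :=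
    (hE.const_mul _).add (hI.const_mul _)
  have hpt : ∀ s ∈ Ioi T, Real.exp (-(m2 / c * s)) * (‖cycleHeatGrad K₀ s (z ν)‖ * ∏ μ ∈ Finset.univ.erase ν, ‖cycleHeat K₀ s (z μ)‖)
      ≤ 8 / (K₀ : ℝ) ^ 3 * (Real.exp (-(8 / (K₀ : ℝ) ^ 2 * s)) / s) + 8 * (1 / (s ^ 2 * Real.sqrt s)) := by
    intro s hs
    have hs0 : 0 < s := lt_trans hT hs
    have hfar := gradProd_le_far (K₀ := K₀) hs0 z ν
    have he1 : Real.exp (-(m2 / c * s)) ≤ 1 := by rw [Real.exp_le_one_iff]; exact neg_nonpos.mpr (by positivity)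
    have hP0 : 0 ≤ ‖cycleHeatGrad K₀ s (z ν)‖ * ∏ μ ∈ Finset.univ.erase ν, ‖cycleHeat K₀ s (z μ)‖ := mul_nonneg (norm_nonneg _) (Finset.prod_nonneg fun μ _ => norm_nonneg _)
    have e : 8 * Real.exp (-(8 * s / (K₀ : ℝ) ^ 2)) / (s * (K₀ : ℝ) ^ 3) + 8 / (s ^ 2 * Real.sqrt s)
        = 8 / (K₀ : ℝ) ^ 3 * (Real.exp (-(8 / (K₀ : ℝ) ^ 2 * s)) / s) + 8 * (1 / (s ^ 2 * Real.sqrt s)) := by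
      rw [show 8 * s / (K₀ : ℝ) ^ 2 = 8 / (K₀ : ℝ) ^ 2 * s by ring]
      field_simp
    calc _ ≤ 1 * (‖cycleHeatGrad K₀ s (z ν)‖ * ∏ μ ∈ Finset.univ.erase ν, ‖cycleHeat K₀ s (z μ)‖) := mul_le_mul_of_nonneg_right he1 hP0
      _ ≤ 8 * Real.exp (-(8 * s / (K₀ : ℝ) ^ 2)) / (s * (K₀ : ℝ) ^ 3) + 8 / (s ^ 2 * Real.sqrt s) := by rw [one_mul]; exact hfar
      _ = _ := e
  have hmono := setIntegral_mono_on hF hG measurableSet_Ioi hpt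
  have hsplit : ∫ s in Ioi T, (8 / (K₀ : ℝ) ^ 3 * (Real.exp (-(8 / (K₀ : ℝ) ^ 2 * s)) / s) + 8 * (1 / (s ^ 2 * Real.sqrt s)))
      = 8 / (K₀ : ℝ) ^ 3 * (∫ s in Ioi T, Real.exp (-(8 / (K₀ : ℝ) ^ 2 * s)) / s) + 8 * ∫ s in Ioi T, 1 / (s ^ 2 * Real.sqrt s) := by
    rw [integral_add (hE.const_mul _) (hI.const_mul _), integral_const_mul, integral_const_mul]
  rw [hsplit] at hmono
  have h1 := integral_Ioi_exp_div_le ha hT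
  have h2 := integral_Ioi_inv_sq_sqrt_le hT
  have hzm : 8 / (K₀ : ℝ) ^ 3 * (∫ s in Ioi T, Real.exp (-(8 / (K₀ : ℝ) ^ 2 * s)) / s) ≤ 1 / (T * K₀) := by
    calc 8 / (K₀ : ℝ) ^ 3 * (∫ s in Ioi T, Real.exp (-(8 / (K₀ : ℝ) ^ 2 * s)) / s) ≤ 8 / (K₀ : ℝ) ^ 3 * (1 / (8 / (K₀ : ℝ) ^ 2 * T)) :=
          mul_le_mul_of_nonneg_left h1 (by positivity)
      _ = 1 / (T * K₀) := by field_simp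
  have h8 : 8 * ∫ s in Ioi T, 1 / (s ^ 2 * Real.sqrt s) ≤ 8 / (T * Real.sqrt T) := by
    calc 8 * ∫ s in Ioi T, 1 / (s ^ 2 * Real.sqrt s) ≤ 8 * (1 / (T * Real.sqrt T)) := mul_le_mul_of_nonneg_left h2 (by norm_num)
      _ = 8 / (T * Real.sqrt T) := by ring
  linarith

/-- ★ REGION I: for `z_μ ≠ 0`, `n = |v(z_μ)|`, every `ν`: `∫_{(0,n²]} e^{−(m²∕c)s}‖∇Q_s(z_ν)‖Π_{μ′≠ν}‖Q_s(z_{μ′})‖ds ≤ 617400∕n³` (PART ∇-d `gradProd_le_near` and `∫₀^{n²}ds∕√s = 2n`).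
[cite: King1986, (2.13) p.653, (4.4) p.670, (4.35) p.674] -/
theorem integral_grad_near_le (hc : 0 < c) (hm : 0 < m2) (z : Tor (cM K₀)) (ν μ : Fin 4) (hμ : z μ ≠ 0) :
    ∫ s in Ioc (0 : ℝ) ((((z μ).valMinAbs.natAbs : ℕ) : ℝ) ^ 2), Real.exp (-(m2 / c * s)) * (‖cycleHeatGrad K₀ s (z ν)‖ * ∏ μ' ∈ Finset.univ.erase ν, ‖cycleHeat K₀ s (z μ')‖)
      ≤ 617400 / (((z μ).valMinAbs.natAbs : ℕ) : ℝ) ^ 3 := by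
  set n : ℝ := (((z μ).valMinAbs.natAbs : ℕ) : ℝ) with hn
  have hnat : 1 ≤ (z μ).valMinAbs.natAbs := by
    rw [Nat.one_le_iff_ne_zero, Ne, Int.natAbs_eq_zero, ZMod.valMinAbs_eq_zero]; exact hμ
  have hn1 : (1 : ℝ) ≤ n := by rw [hn]; exact_mod_cast hnat
  have hn0 : 0 < n := by linarith
  have hT : 0 < n ^ 2 := by positivity
  have hF := (integrableOn_gradMajorant_cM hc hm z ν).mono_set (Ioc_subset_Ioi_self : Ioc (0 : ℝ) (n ^ 2) ⊆ Ioi 0)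
  have hG : IntegrableOn (fun s : ℝ => 308700 / n ^ 4 * (Real.sqrt s)⁻¹) (Ioc (0 : ℝ) (n ^ 2)) := (integrableOn_inv_sqrt_Ioc (n ^ 2)).const_mul _
  have hpt : ∀ s ∈ Ioc (0 : ℝ) (n ^ 2), Real.exp (-(m2 / c * s)) * (‖cycleHeatGrad K₀ s (z ν)‖ * ∏ μ' ∈ Finset.univ.erase ν, ‖cycleHeat K₀ s (z μ')‖)
      ≤ 308700 / n ^ 4 * (Real.sqrt s)⁻¹ := by
    intro s hs
    have hnear := gradProd_le_near (K₀ := K₀) hs.1 z ν μ hμ hs.2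
    have he1 : Real.exp (-(m2 / c * s)) ≤ 1 := by rw [Real.exp_le_one_iff]; exact neg_nonpos.mpr (by have := hs.1; positivity)
    have hP0 : 0 ≤ ‖cycleHeatGrad K₀ s (z ν)‖ * ∏ μ' ∈ Finset.univ.erase ν, ‖cycleHeat K₀ s (z μ')‖ := mul_nonneg (norm_nonneg _) (Finset.prod_nonneg fun μ' _ => norm_nonneg _)
    calc _ ≤ 1 * (308700 / (n ^ 4 * Real.sqrt s)) := mul_le_mul he1 hnear hP0 zero_le_one
      _ = 308700 / n ^ 4 * (Real.sqrt s)⁻¹ := by rw [one_mul, div_mul_eq_div_mul_one_div, one_div]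
  have hmono := setIntegral_mono_on hF hG measurableSet_Ioc hpt
  rw [integral_const_mul, integral_Ioc_inv_sqrt hT, Real.sqrt_sq hn0.le] at hmono
  calc _ ≤ 308700 / n ^ 4 * (2 * n) := hmono
    _ = 617400 / n ^ 3 := by field_simp; ring

end Summit.QuantumFields.YangMills.BalabanUVNodes.N15KingModelRung.HeatKernel

end
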